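import Summits.BirchSwinnertonDyer.BirchSwinnertonDyer.Theorems.EisensteinPrimesMazurMCOnX1RankZeroInterludeCoreDescent
import HarnessLib

/-!
# Interlude line, crux 5 `MazurMCOnX1RankZero` — the crux BY NAME from the stubs with XI° in place of XI″ (CONDITIONAL)

Helper for the line `interlude_with_torsion` of crux 5 (stmt-BirchSwinnertonDyer-19035), LEAD cruxlead-19035 g0. The tree's
conditional closure `mazurMCOnX1RankZero_of_stubs` (`…InterludeCoreDescent`, p686428) takes the PRE atom in the form XI″
(`PublishedFacts → PublishedFactsII → FourTermAtSomeLattice`, the four-term identities of the PROOF of CGS Prop. 4.2.1 at `α = 𝟙`)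
and uses it only through the elimination `crossTransferSome_of_fourTermSome : FourTermAtSomeLattice → CrossTransferAtSomeLattice`.
This file records the sharper bookkeeping: the SAME conclusion from the WEAKER door XI° (`CrossTransferAtSomeLattice` = the two
divisibility transfers of CGS Prop. 4.2.1 itself at `α = 𝟙` at some member of the class — statement-level print, PRE rider
⇐ Cor. 4.1.3 ⇐ Thm. 4.1.1 ⇐ BSTW24 §5), everything else token-identical; and the one-line recovery of the XI″ form from it.
HONEST FRAMING: both theorems are CONDITIONAL on the registered stub types (PUB named facts, the route's crux 2, XI°/XI″, road B's
(B3) and (B1c)); nothing about any curve, no summit statement (BSD, Mazur's MC, IMC2) and no crux is proved here.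
[cite: CastellaGrossiSkinner2025, Prop. 4.2.1, §5 (Interlude)] [cite: KellerYin2024, Thm. 3.0.8]
-/

noncomputable section

open scoped Classical MatrixGroups ModularForm

open CongruenceSubgroup WeierstrassCurve NumberField IsDedekindDomain Field
  Literature.NumberTheory.EllipticCurves Literature.NumberTheory.EllipticCurves.ModularForms
  Literature.NumberTheory.EllipticCurves.Rank1Residual Literature.NumberTheory.GaloisRepresentations
  Literature.NumberTheory.EllipticCurves.CyclotomicZp Literature.NumberTheory.EllipticCurves.Castella2018
  Literature.NumberTheory.QuadraticFields

namespace Summit.BirchSwinnertonDyer.BirchSwinnertonDyer.Theorems.InterludeWithTorsion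

/-- **Crux 5 `MazurMCOnX1RankZero` BY NAME, CONDITIONALLY on the stub types with the PRE atom in the form XI°**
(`PublishedFacts → PublishedFactsII → CrossTransferAtSomeLattice`: the two divisibility transfers of CGS Prop. 4.2.1 at
`α = 𝟙` at SOME member of the isogeny class, no `K`-torsion hypothesis) instead of XI″ (the four-term identities of its proof);
the other four hypotheses are token-identical to `mazurMCOnX1RankZero_of_stubs` (PUB ×15 ∧ PUB-II ∧ CGS Prop. 3.4.2 ∧ KO Prop. 2.9;
the route's crux 2; road B's (B3) `ResidualGL1FinitenessOdd`; (B1c) `RoadBResidueP`). Same assembly: PUB-II ⟹ a frame; PUB ∘ crux 2 ∘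
KO Prop. 2.9 ⟹ the anticyclotomic class value ⟹ Step 1⁺ ⊕ GV; XI°; (B3) + (B1c) ⟹ K2⁺; ISO; Steps 2–3 core; descent. CONDITIONAL —
BSD / Mazur's MC / IMC2 are NOT proved by this theorem. [cite: CastellaGrossiSkinner2025, Prop. 4.2.1, §5 (Interlude)]
[cite: KellerYin2024, Thm. 3.0.8] [cite: GreenbergLNM1716, §5 Prop. 5.10] [cite: BurungaleSkinnerTianWan2024, §5] -/
theorem mazurMCOnX1RankZero_of_stubs_xi0
    (hPub : PublishedFacts ∧ PublishedFactsII ∧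
      CastellaGrossiSkinner2025.prop342_twoLineEulerChar_trivialChar ∧
      KobayashiOta2020.prop29_charIdeal_XGr_anticyclotomic_eq_of_isIsogenous)
    (h2 : Summit.BirchSwinnertonDyer.BirchSwinnertonDyer.Theses.EisensteinPrimes.GoodLatticeBDPValue)
    (hXI0 : PublishedFacts → PublishedFactsII → CrossTransferAtSomeLattice)
    (hGL1 : ResidualGL1FinitenessOdd) (hB1c : RoadBResidueP) :
    Summit.BirchSwinnertonDyer.BirchSwinnertonDyer.Theses.EisensteinPrimes.MazurMCOnX1RankZero :=
  have hminus : MinusLineValueClass := minusLineValue_class_of_goodLattice h2 hPub.2.2.2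
  mazurMCOnX1RankZero_of_node hPub.1
    (stepsTwoThree_of_pieces_someLattice (frameData_of_publishedII hPub.2.1)
      (plusCharValue_of_published hPub.1 hPub.2.1 hPub.2.2.1 hminus)
      (xGrCharIdealIsogenyInvariantCyc_of_kerSelmerMapFiniteOfDegreeP (hB1c hGL1))
      (hXI0 hPub.1 hPub.2.1) (isoTransportK_of_published hPub.1) hPub.1 hPub.2.2.1 hminus)

/-- The XI″ door of the skeleton (`PublishedFacts → PublishedFactsII → FourTermAtSomeLattice`, registered stub
`stub_fourTermSomeLattice` of v8–v12) IMPLIES the XI° door (`… → CrossTransferAtSomeLattice`) by the tree's elimination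
`crossTransferSome_of_fourTermSome`; so XI° is the weaker door and `mazurMCOnX1RankZero_of_stubs` (p686428) factors through
`mazurMCOnX1RankZero_of_stubs_xi0`. Pure bookkeeping; nothing about any curve is proved.
[cite: CastellaGrossiSkinner2025, Prop. 4.2.1 (proof)] -/
theorem xi0Door_of_fourTermDoor (hXI : PublishedFacts → PublishedFactsII → FourTermAtSomeLattice) :
    PublishedFacts → PublishedFactsII → CrossTransferAtSomeLattice :=
  fun hP hP2 => crossTransferSome_of_fourTermSome (hXI hP hP2)

end Summit.BirchSwinnertonDyer.BirchSwinnertonDyer.Theorems.InterludeWithTorsion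

end
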